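import Literature.Algebra.EuclideanLattices.KhotExplicitReduction
import Literature.Computability.Complexity.CodeFPBudgets
import Literature.Computability.Complexity.CodeFPLists
import HarnessLib

/-!
# Khot 2005, §7.3 on codes: the explicit parameters of the reduction are polynomial-time

Topic `Algebra/EuclideanLattices`, namespace `Literature.Algebra.EuclideanLattices.Khot`. Support file
for the machine hypothesis of `gapSVP_const_isNPHardRandomized_of_prop6_of_FP_explicit`
(`KhotExplicitReduction.lean`). The parameters of `KhotParameters.lean` (`Params.MM`, `NN`, `hh`,
`rows`, `ss`, `DD`, `qq`, `tauN`, …; `KhotReduction.lean`: `lq`, `q₂`, `Lg`; `KhotExplicitReduction.lean`: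
`cols`) are functions of the sizes `(u, σ, K)` of a set cover instance and the number `k` of
levels. This file computes them ON CODES by polynomial-time string functions (the typed algebra
`CodeFP`), from the size datum `(1ⁿ, u, σ, K)` of an instance on the guard — `n` the code length,
`1 ≤ K ≤ n`, `u, σ ≤ n` (`guard_sizes_le`), the type `PDom` — in binary, and IN UNARY for every
quantity that is later a dimension, a loop count or an exponent: `K`, `u`, `σ` (bounded by `n`), `M`
(bounded by bit lengths), `N = 2^M` (bounded by `2^{2β_k} n^{2α_k}`, `NN_le`), `h`, `rows`, `cols`,
`lq = log₂ qq + 1` (the bit length of `qq`). No machines written, no new facts.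

## References

* S. Khot, *Hardness of approximating the shortest vector problem in lattices*, J. ACM 52 (2005)
  789–808, §7.3 (the reduction runs in time `n^{O(k²)}`).
* S. Arora, B. Barak, *Computational Complexity: A Modern Approach*, CUP 2009, §1.3.
-/

namespace Literature.Algebra.EuclideanLattices.Khot

open Literature.Computability.Complexity Literature.Computability.Complexity.CodeFP Params

/-! ### Generic numerals -/

section Numerals

variable {α β : Type} {eα : α → List Bool} {eβ : β → List Bool}

/-- Restriction of a computed map to a subtype of its domain (same codes). [folklore] -/
theorem _root_.Literature.Computability.Complexity.CodeFP.subtype {P : α → Prop} {g : α → β}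
    (h : CodeFP eα eβ g) : CodeFP (fun a : {a // P a} => eα a.val) eβ (fun a => g a.val) := by
  obtain ⟨f, hf, hfg⟩ := h
  exact ⟨f, hf, fun a => hfg a.val⟩

/-- Binary constant powers `x ↦ x^e`. [cite: AroraBarak2009, §1.3] -/
theorem natPowC (e : ℕ) : CodeFP natE natE (fun x => x ^ e) :=
  (natPow.comp ((CodeFP.id natE).pair (const natE e))).congr fun _ => rfl

/-- Binary constant multiples `x ↦ c·x`. [cite: AroraBarak2009, §1.3] -/
theorem natMulC (c : ℕ) : CodeFP natE natE (fun x => c * x) :=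
  (natMul.comp ((const natE c).pair (CodeFP.id natE))).congr fun _ => rfl

/-- `log₂ x ≤ |x|₂` (the bit length). [folklore] -/
theorem log2_le_size (x : ℕ) : Nat.log 2 x ≤ Nat.size x := by
  rcases Nat.eq_zero_or_pos x with rfl | hx
  · simp
  · exact (Nat.log_lt_of_lt_pow (Nat.pos_iff_ne_zero.1 hx) (Nat.lt_size_self x)).le

/-- `|x|₂ = log₂ x + 1` for `x ≥ 1`. [folklore] -/
theorem size_eq_log2_succ {x : ℕ} (hx : 1 ≤ x) : Nat.size x = Nat.log 2 x + 1 := by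
  apply le_antisymm
  · exact Nat.size_le.2 (Nat.lt_pow_succ_log_self (by norm_num) x)
  · have h1 : 2 ^ Nat.log 2 x ≤ x := Nat.pow_log_le_self 2 (by omega)
    have h2 : x < 2 ^ Nat.size x := Nat.lt_size_self x
    have : Nat.log 2 x < Nat.size x := (Nat.pow_lt_pow_iff_right (by norm_num)).1 (h1.trans_lt h2)
    omega

/-- **Binary logarithm on codes** (the budget of the doubling scan is the numeral itself).
[cite: AroraBarak2009, §1.3] -/
theorem natLog2 : CodeFP natE natE (Nat.log 2) :=
  (natLog2Min.comp ((CodeFP.id natE).pair (replicateUnit.comp (strLength.comp strOfNat)))).congr fun x => by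
    simp only [id, List.length_replicate]
    exact min_eq_right ((log2_le_size x).trans (length_natE x).ge)

/-- The bit length of a binary numeral, in unary. (Deliberate duplicate of
`Literature.Computability.QuantumComplexity.natSizeU_codeFP`, `HidingProgramMachine.lean`, which lies
outside this file's import closure — a quantum-sampling machine file is not imported into the lattice
cone for a two-line brick.) [folklore] -/
theorem unSize : CodeFP natE unE Nat.size := (strLength.comp strOfNat).congr fun x => length_natE x

/-- **Unary from binary under a computed unary bound.** [cite: AroraBarak2009, §1.3] -/
theorem unOfNat_of_le {X B : α → ℕ} (hX : CodeFP eα natE X) (hB : CodeFP eα unE B) (h : ∀ a, X a ≤ B a) :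
    CodeFP eα unE X :=
  (unOfNatMin.comp (hB.pair hX)).congr fun a => min_eq_left (h a)

/-- Branching on a decidable PROPOSITION whose decision is computed on codes. [cite: AroraBarak2009, §1.3] -/
theorem iteP {c : α → Prop} [DecidablePred c] {g h : α → β} (hc : CodeFP eα bitE (fun a => decide (c a)))
    (hg : CodeFP eα eβ g) (hh : CodeFP eα eβ h) : CodeFP eα eβ (fun a => if c a then g a else h a) :=
  (ite hc hg hh).congr fun a => by by_cases h : c a <;> simp [h]

/-- Unary multiplication. (Deliberate duplicate of
`Literature.Computability.QuantumComplexity.unMul_codeFP`, `HidingProgramMachine.lean`, outside this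
file's import closure, see `unSize`.) [cite: AroraBarak2009, §1.3] -/
theorem unMul : CodeFP (pairE unE unE) unE (fun p => p.1 * p.2) :=
  ((ulength unitE).comp (unitsMul.comp ((replicateUnit.comp (fst _ _)).pair (replicateUnit.comp (snd _ _))))).congr
    fun p => by simp

/-- Unary constant powers `n ↦ n^e`. [cite: AroraBarak2009, §1.3] -/
theorem unPowC : ∀ e : ℕ, CodeFP unE unE (fun n => n ^ e)
  | 0 => (const unE 1).congr fun n => by simp
  | e + 1 => (unMul.comp ((unPowC e).pair (CodeFP.id unE))).congr fun n => by simp [pow_succ]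

/-- `outCard r c j` in unary, from `(1ʳ, 1ᶜ)`. [folklore] -/
theorem outCardFP : ∀ j : ℕ, CodeFP (pairE unE unE) unE (fun p => outCard p.1 p.2 j)
  | 0 => (fst _ _).congr fun _ => rfl
  | j + 1 => ((unAdd.comp ((unMul.comp ((fst _ _).pair ((unPowC (j + 1)).comp (snd _ _)))).pair
      (unMul.comp ((fst _ _).pair (outCardFP j))))).congr fun _ => rfl)

/-- `padCard r c d j` in unary, from `(1ʳ, 1ᶜ, 1ᵈ)`. [folklore] -/
theorem padCardFP : ∀ j : ℕ, CodeFP (pairE unE (pairE unE unE)) unE (fun p => padCard p.1 p.2.1 p.2.2 j)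
  | 0 => (snd _ _).snd'.congr fun _ => rfl
  | j + 1 => ((unAdd.comp ((unMul.comp ((snd _ _).snd'.pair ((unPowC (j + 1)).comp (snd _ _).fst'))).pair
      (unMul.comp ((fst _ _).pair ((outCardFP j).comp ((fst _ _).pair (snd _ _).fst')))))).congr fun _ => rfl)

/-- Integer remainder with Lean's conventions (`Int.emod`), from `ediv`. [folklore] -/
theorem intEMod : CodeFP (pairE intE intE) intE (fun p => p.1 % p.2) :=
  ((intSub.comp ((fst _ _).pair (intMul.comp ((snd _ _).pair intEDiv)))).congr fun p => (Int.emod_def p.1 p.2).symm)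

/-- Unary constant multiples `1ˣ ↦ 1^{c·x}`. [cite: AroraBarak2009, §1.3] -/
theorem unMulC (c : ℕ) : CodeFP unE unE (fun x => c * x) :=
  ((ulength unitE).comp (unitsMul.comp ((replicateUnit.comp (const unE c)).pair replicateUnit))).congr fun x => by
    simp

end Numerals

/-! ### The size datum of an instance on the guard -/

/-- **The size datum `(n, u, σ, K)` of a set cover instance on the guard**: `n` the code length,
`1 ≤ K ≤ n`, `u ≤ n`, `σ ≤ n` (`guard_sizes_le`). [folklore] -/
def PDom : Type := {p : ℕ × (ℕ × (ℕ × ℕ)) // 1 ≤ p.2.2.2 ∧ p.2.2.2 ≤ p.1 ∧ p.2.1 ≤ p.1 ∧ p.2.2.1 ≤ p.1}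

namespace PDom

/-- The code length `n`. [folklore] -/
def n (p : PDom) : ℕ := p.val.1
/-- The universe size `u`. [folklore] -/
def u (p : PDom) : ℕ := p.val.2.1
/-- The number of sets `σ`. [folklore] -/
def σ (p : PDom) : ℕ := p.val.2.2.1
/-- The cover size `K`. [folklore] -/
def K (p : PDom) : ℕ := p.val.2.2.2

/-- `K ≥ 1` on the guard. [folklore] -/
theorem one_le_K (p : PDom) : 1 ≤ p.K := p.property.1
/-- `K ≤ n` on the guard. [folklore] -/
theorem K_le_n (p : PDom) : p.K ≤ p.n := p.property.2.1
/-- `u ≤ n` on the guard. [folklore] -/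
theorem u_le_n (p : PDom) : p.u ≤ p.n := p.property.2.2.1
/-- `σ ≤ n` on the guard. [folklore] -/
theorem σ_le_n (p : PDom) : p.σ ≤ p.n := p.property.2.2.2

end PDom

/-- The code of the size datum: `(1ⁿ, u, σ, K)`, `n` in unary, the sizes in binary. [folklore] -/
def pdE : PDom → List Bool := fun p => pairE unE (pairE natE (pairE natE natE)) p.val

namespace PDom

/-- `n` (unary) is read off the code. [folklore] -/
theorem nFP : CodeFP pdE unE PDom.n := ((fst _ _).subtype :)
/-- `u` (binary) is read off the code. [folklore] -/
theorem uFP : CodeFP pdE natE PDom.u := ((snd _ _).fst'.subtype :)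
/-- `σ` (binary) is read off the code. [folklore] -/
theorem σFP : CodeFP pdE natE PDom.σ := ((snd _ _).snd'.fst'.subtype :)
/-- `K` (binary) is read off the code. [folklore] -/
theorem KFP : CodeFP pdE natE PDom.K := ((snd _ _).snd'.snd'.subtype :)

/-- `K` in unary. [cite: AroraBarak2009, §1.3] -/
theorem KunFP : CodeFP pdE unE PDom.K := unOfNat_of_le KFP nFP K_le_n
/-- `u` in unary. [cite: AroraBarak2009, §1.3] -/
theorem uunFP : CodeFP pdE unE PDom.u := unOfNat_of_le uFP nFP u_le_n
/-- `σ` in unary. [cite: AroraBarak2009, §1.3] -/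
theorem σunFP : CodeFP pdE unE PDom.σ := unOfNat_of_le σFP nFP σ_le_n

/-- `c·K` in unary. [cite: AroraBarak2009, §1.3] -/
theorem cKunFP (c : ℕ) : CodeFP pdE unE (fun p => c * p.K) := (unMulC c).comp KunFP
/-- `c·K` in binary. [cite: AroraBarak2009, §1.3] -/
theorem cKFP (c : ℕ) : CodeFP pdE natE (fun p => c * p.K) := (natMulC c).comp KFP

end PDom

/-! ### The parameters on codes -/

section Parameters

open PDom

variable (k : ℕ)

/-- `S₀ K` in binary. [cite: Khot2005, §7.3] -/
theorem S₀FP : CodeFP pdE natE (fun p => S₀ p.K) := by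
  have h : CodeFP pdE natE (fun p => 32 * p.K + 1 + 40 * p.K * (31 * p.K) ^ 2 + (35 * p.K) ^ 2) :=
    (natAdd.comp ((natAdd.comp ((natAdd.comp ((cKFP 32).pair (const _ 1))).pair
      (natMul.comp ((cKFP 40).pair ((natPowC 2).comp (cKFP 31)))))).pair ((natPowC 2).comp (cKFP 35))) :)
  exact h.congr fun p => by simp [S₀]

/-- `D₀ K k` in binary. [cite: Khot2005, §7.3] -/
theorem D₀FP : CodeFP pdE natE (fun p => D₀ p.K k) := by
  have h : CodeFP pdE natE (fun p => S₀ p.K ^ k * (40 * p.K) ^ (k + 1)) :=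
    (natMul.comp (((natPowC k).comp S₀FP).pair ((natPowC (k + 1)).comp (cKFP 40))) :)
  exact h.congr fun p => rfl

/-- `A u σ K k` in binary (exponents `20K`, `31K`, `10K` in unary). [cite: Khot2005, §7.3] -/
theorem AFP : CodeFP pdE natE (fun p => A p.u p.σ p.K k) := by
  have h1 : CodeFP pdE natE (fun p => 2 * 10 ^ 8 * p.K) := (cKFP (2 * 10 ^ 8) :)
  have h2 : CodeFP pdE natE (fun p => 2 ^ (20 * p.K)) := (natPow.comp ((const _ 2).pair (cKunFP 20)) :)
  have h3 : CodeFP pdE natE (fun p => (31 * p.K) ^ (31 * p.K)) := (natPow.comp ((cKFP 31).pair (cKunFP 31)) :)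
  have h4 : CodeFP pdE natE (fun p => (p.u + p.σ + 40 * p.K + 1) ^ (10 * p.K)) :=
    (natPow.comp ((natAdd.comp ((natAdd.comp ((natAdd.comp (uFP.pair σFP)).pair (cKFP 40))).pair (const _ 1))).pair
      (cKunFP 10)) :)
  have h5 : CodeFP pdE natE (fun p => 2 ^ (10 * p.K)) := (natPow.comp ((const _ 2).pair (cKunFP 10)) :)
  have h6 : CodeFP pdE natE (fun p => D₀ p.K k ^ (10 * p.K)) := (natPow.comp ((D₀FP k).pair (cKunFP 10)) :)
  have h : CodeFP pdE natE (fun p => 2 * 10 ^ 8 * p.K * 2 ^ (20 * p.K) * (31 * p.K) ^ (31 * p.K) *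
      (p.u + p.σ + 40 * p.K + 1) ^ (10 * p.K) * 2 ^ (10 * p.K) * D₀ p.K k ^ (10 * p.K)) :=
    (natMul.comp ((natMul.comp ((natMul.comp ((natMul.comp ((natMul.comp (h1.pair h2)).pair h3)).pair h4)).pair
      h5)).pair h6) :)
  exact h.congr fun p => rfl

/-- `M' u σ K k` in binary. [cite: Khot2005, §7.3] -/
theorem M'FP : CodeFP pdE natE (fun p => M' p.u p.σ p.K k) := by
  have h1 : CodeFP pdE natE (fun p => (Nat.log 2 (A p.u p.σ p.K k) + 1) / (p.K + 1)) :=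
    (natDiv.comp ((natAdd.comp ((natLog2.comp (AFP k)).pair (const _ 1))).pair (natAdd.comp (KFP.pair (const _ 1)))) :)
  have h2 : CodeFP pdE natE (fun p => Nat.log 2 (200 * (31 * p.K) ^ 2) + 1) :=
    (natAdd.comp ((natLog2.comp ((natMulC 200).comp ((natPowC 2).comp (cKFP 31)))).pair (const _ 1)) :)
  have h : CodeFP pdE natE (fun p => (Nat.log 2 (A p.u p.σ p.K k) + 1) / (p.K + 1) + 1 + (16 * Ep k ^ 2 + 16) +
      (Nat.log 2 (200 * (31 * p.K) ^ 2) + 1)) :=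
    (natAdd.comp ((natAdd.comp ((natAdd.comp (h1.pair (const _ 1))).pair (const _ (16 * Ep k ^ 2 + 16)))).pair h2) :)
  exact h.congr fun p => rfl

/-- `M = MM u σ K k` in binary. [cite: Khot2005, §7.3] -/
theorem MMFP : CodeFP pdE natE (fun p => MM p.u p.σ p.K k) := ((natMulC 2).comp (M'FP k)).congr fun _ => rfl

/-- **`M` in unary**: bounded by bit lengths, `M ≤ 2(|A|₂ + 1 + 1 + c_k + |200(31K)²|₂ + 1)`.
[cite: Khot2005, §7.3; AroraBarak2009, §1.3] -/
theorem MMunFP : CodeFP pdE unE (fun p => MM p.u p.σ p.K k) := by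
  have hB : CodeFP pdE unE (fun p => 2 * ((Nat.size (A p.u p.σ p.K k) + 1) + 1 + (16 * Ep k ^ 2 + 16) +
      (Nat.size (200 * (31 * p.K) ^ 2) + 1))) :=
    ((unMulC 2).comp (unAdd.comp ((unAdd.comp ((unAdd.comp ((unSucc.comp (unSize.comp (AFP k))).pair
      (const _ 1))).pair (const _ (16 * Ep k ^ 2 + 16)))).pair (unSucc.comp (unSize.comp ((natMulC 200).comp
        ((natPowC 2).comp (cKFP 31))))))) :)
  refine unOfNat_of_le (MMFP k) hB fun p => ?_
  unfold MM M'
  have h1 : (Nat.log 2 (A p.u p.σ p.K k) + 1) / (p.K + 1) ≤ Nat.size (A p.u p.σ p.K k) + 1 :=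
    (Nat.div_le_self _ _).trans (by have := log2_le_size (A p.u p.σ p.K k); omega)
  have h2 := log2_le_size (200 * (31 * p.K) ^ 2)
  omega

/-- `N = 2^M` in binary. [cite: Khot2005, §7.3] -/
theorem NNFP : CodeFP pdE natE (fun p => NN p.u p.σ p.K k) :=
  (natPow.comp ((const _ 2).pair (MMunFP k))).congr fun _ => rfl

/-- **`N` in unary**: `N ≤ 2^{2β_k} n^{2α_k}` on the guard (`NN_le`). [cite: Khot2005, §7.3; AroraBarak2009, §1.3] -/
theorem NNunFP : CodeFP pdE unE (fun p => NN p.u p.σ p.K k) :=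
  unOfNat_of_le (NNFP k) (unMul.comp ((const _ (2 ^ (2 * βk k))).pair ((unPowC (2 * αk k)).comp nFP)))
    fun p => NN_le p.one_le_K p.K_le_n p.u_le_n p.σ_le_n

/-- `h = 20K(M+1)` in binary. [cite: Khot2005, §7.3] -/
theorem hhFP : CodeFP pdE natE (fun p => hh p.u p.σ p.K k) :=
  (natMul.comp ((cKFP 20).pair (natAdd.comp ((MMFP k).pair (const _ 1))))).congr fun _ => rfl

/-- `h` in unary. [cite: Khot2005, §7.3; AroraBarak2009, §1.3] -/
theorem hhunFP : CodeFP pdE unE (fun p => hh p.u p.σ p.K k) :=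
  (unMul.comp ((cKunFP 20).pair (unSucc.comp (MMunFP k)))).congr fun _ => rfl

/-- `rows = u + σ + h + N` in binary. [cite: Khot2005, §7.3] -/
theorem rowsFP : CodeFP pdE natE (fun p => rows p.u p.σ p.K k) :=
  (natAdd.comp ((natAdd.comp ((natAdd.comp (uFP.pair σFP)).pair (hhFP k))).pair (NNFP k))).congr fun _ => rfl

/-- `rows` in unary. [cite: Khot2005, §7.3; AroraBarak2009, §1.3] -/
theorem rowsunFP : CodeFP pdE unE (fun p => rows p.u p.σ p.K k) :=
  (unAdd.comp ((unAdd.comp ((unAdd.comp (uunFP.pair σunFP)).pair (hhunFP k))).pair (NNunFP k))).congr fun _ => rfl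

/-- `cols = σ + (N + h) + 1 + 1` in unary. [cite: Khot2005, §7.3; AroraBarak2009, §1.3] -/
theorem colsunFP : CodeFP pdE unE (fun p => cols p.u p.σ p.K k) :=
  (unSucc.comp (unSucc.comp (unAdd.comp (σunFP.pair (unAdd.comp ((NNunFP k).pair (hhunFP k))))))).congr fun _ => rfl

/-- `s = ss u σ K k` in binary. [cite: Khot2005, §7.3] -/
theorem ssFP : CodeFP pdE natE (fun p => ss p.u p.σ p.K k) := by
  have h : CodeFP pdE natE (fun p => p.K + (31 * p.K + hh p.u p.σ p.K k * (31 * p.K) ^ 2) + 1 + (35 * p.K) ^ 2) :=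
    (natAdd.comp ((natAdd.comp ((natAdd.comp (KFP.pair (natAdd.comp ((cKFP 31).pair (natMul.comp ((hhFP k).pair
      ((natPowC 2).comp (cKFP 31)))))))).pair (const _ 1))).pair ((natPowC 2).comp (cKFP 35))) :)
  exact h.congr fun p => rfl

/-- `D = DD u σ K k = s^k (40K)^{k+1}` in binary. [cite: Khot2005, §7.3] -/
theorem DDFP : CodeFP pdE natE (fun p => DD p.u p.σ p.K k) :=
  (natMul.comp (((natPowC k).comp (ssFP k)).pair ((natPowC (k + 1)).comp (cKFP 40)))).congr fun _ => rfl

/-- `W = s^k` in binary. [cite: Khot2005, §7 Eq. (2)] -/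
theorem WFP : CodeFP pdE natE (fun p => ss p.u p.σ p.K k ^ k) := (natPowC k).comp (ssFP k)

/-- `Abound u σ K k` in binary (the exponent `(40K-1)/4 ≤ 40K` in unary). [cite: Khot2005, §7.3] -/
theorem AboundFP : CodeFP pdE natE (fun p => Abound p.u p.σ p.K k) := by
  have he : CodeFP pdE natE (fun p => (40 * p.K - 1) / 4) :=
    (natDiv.comp ((natSub.comp ((cKFP 40).pair (const _ 1))).pair (const _ 4)) :)
  have heu : CodeFP pdE unE (fun p => (40 * p.K - 1) / 4) :=
    unOfNat_of_le he (cKunFP 40) fun p => (Nat.div_le_self _ _).trans (Nat.sub_le _ _)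
  have h : CodeFP pdE natE (fun p => ((40 * p.K - 1) / 4 + 1) * rows p.u p.σ p.K k ^ ((40 * p.K - 1) / 4) *
      (2 * DD p.u p.σ p.K k) ^ ((40 * p.K - 1) / 4)) :=
    (natMul.comp ((natMul.comp ((natAdd.comp (he.pair (const _ 1))).pair (natPow.comp ((rowsFP k).pair heu)))).pair
      (natPow.comp (((natMulC 2).comp (DDFP k)).pair heu))) :)
  exact h.congr fun p => rfl

/-- `qq = max 1 (100 · Abound · D)` in binary. [cite: Khot2005, §5.2.1 and §7.3] -/
theorem qqFP : CodeFP pdE natE (fun p => qq p.u p.σ p.K k) :=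
  (natMax.comp ((const _ 1).pair (natMul.comp (((natMulC 100).comp (AboundFP k)).pair (DDFP k))))).congr fun _ => rfl

/-- `lq = log₂ qq + 1` in binary. [cite: Khot2005, §5.2.2] -/
theorem lqFP : CodeFP pdE natE (fun p => lq p.u p.σ p.K k) :=
  (natAdd.comp ((natLog2.comp (qqFP k)).pair (const _ 1))).congr fun _ => rfl

/-- **`lq` in unary**: it is the bit length of `qq ≥ 1`. [cite: Khot2005, §5.2.2; AroraBarak2009, §1.3] -/
theorem lqunFP : CodeFP pdE unE (fun p => lq p.u p.σ p.K k) :=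
  (unSize.comp (qqFP k)).congr fun p => by
    unfold lq
    exact size_eq_log2_succ (by unfold qq; exact le_max_left _ _)

/-- `q₂ = 2^{lq}` in binary. [cite: Khot2005, §5.2.2] -/
theorem q₂FP : CodeFP pdE natE (fun p => q₂ p.u p.σ p.K k) :=
  (natPow.comp ((const _ 2).pair (lqunFP k))).congr fun _ => rfl

/-- `tauN = ⌊√XX⌋ + 1` in binary, `XX = 2 (s^k)² (35K)^{k+1}`. [cite: Khot2005, §7.3] -/
theorem tauNFP : CodeFP pdE natE (fun p => tauN p.u p.σ p.K k) := by
  have hX : CodeFP pdE natE (fun p => 2 * (ss p.u p.σ p.K k ^ k) ^ 2 * (35 * p.K) ^ (k + 1)) :=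
    (natMul.comp (((natMulC 2).comp ((natPowC 2).comp (WFP k))).pair ((natPowC (k + 1)).comp (cKFP 35))) :)
  exact (natAdd.comp ((natSqrt.comp hX).pair (const _ 1))).congr fun p => rfl

/-- `Lg = 31K · M` (coins of the tuple) in unary. [cite: Khot2005, Lemma 4.3 and §5.1] -/
theorem LgunFP : CodeFP pdE unE (fun p => Lg p.u p.σ p.K k) :=
  (unMul.comp ((cKunFP 31).pair (MMunFP k))).congr fun _ => rfl

end Parameters

end Literature.Algebra.EuclideanLattices.Khot
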